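import Summits.QuantumFields.BalabanUV.Beta.FP.StationarityK
import Summits.QuantumFields.BalabanUV.Beta.FP.StationarityJConvC
import Summits.QuantumFields.BalabanUV.Beta.FP.TransportInfinityM
import Summits.QuantumFields.BalabanUV.Beta.GAN24.KSlotAssembly

/-!
# `BalabanUV.Beta.FP.KSlotHolds` — road «FP» for binder row D1: the `m = 1` K-SIDE HYPOTHESES OF THREE LANDED FP LEAVES DISCHARGED IN DIMENSION FOUR
# (`d = 3`, every `Lc ≥ 2`, adopted units `(sfStep Lc, smStep 3 Lc)`) by gan24's END node `GAN24.KSlotAssembly.convCKWall_holds : 2 ≤ Lc → ConvCKWall 3 Lc`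
# (p204341) BY NAME — N1-K∞ at `m = 0` (`StationarityK.dec_KPerf_succ_of_decays`), N5b-2 at `m = 1` (`TransportInfinityM.entryHyps_perfCol`),
# N1-J∞'s transport side (`StationarityJConvC.SPerfOf_SDec_succ_of_KSlot`)

HONEST FRAMING (cell contract, verbatim): «discharging `BetaPertH` makes Bałaban's UV stability UNCONDITIONAL — a real constructive-QFT result;
it is NOT the continuum limit and NOT the Clay problem.»  HEADLINE DISCIPLINE (as `KSlotAssembly`, ruling C2/c4): each theorem below removes EXACTLY the
K-slot binders (`UnitDecayK`/`CauchyDecayK`, resp. the `hK`/`hKall` shapes at `m = 1`) from a landed FP theorem and NOTHING ELSE — the S/W slots (X1m-S: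
`hUb`/`hU`), the Ward data of the transported kernel (`hT hT0 hT1`), the (j, m)-families for `m ≥ 2`, the identification (D1) remain HYPOTHESES where they
were; NOT «N1/N5 closed», NOT «G-an2-4 closed», NOT BetaPertH, NOT continuum, NOT Clay; 0 wall binders instantiated.  Claim table
`HOME/b2b-balaban-beta-d1-p3/LEAVES-FP.md` (rows N1-K∞, N1-J-convC, N5b-2; unit `b2b-balaban-beta-d1-formalise-leaf-06`).
ABSOLUTE RULE (cell, verbatim): «No internally-minted statement may enter as a cited fact. Every hypothesis is either kernel-proved in this package or a
verbatim quotation of a PUBLISHED theorem with page reference.»  Nothing is cited; no `def … : Prop`; every input is a tree THEOREM imported BY NAME.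

CONTENT (all [our object] / [folklore]).
* §1 units bookkeeping: `sfStep_succ`, `smStep_succ` (the adopted units are GEOMETRIC, ratios `Lc`, `Lc^{d+1}`), `sfStep_mul_smStep_three` (the bond-unit pin
  `s_f(j)·s_m(j) = Lc^{5j}` of `TransportInfinityM`/`StepLawAssembly` HOLDS for the adopted units at `d = 3`).
* §2 **`dec_KPerf_one_holds`** `(hLc : 2 ≤ Lc)`: `dec Lc (KPerf Lc (sfStep Lc) (smStep 3 Lc) 1) = unitK Lc⁻¹ (Lc⁴)⁻¹ (KPerf Lc (sfStep Lc) (smStep 3 Lc) 0)` — the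
  fixed-point property at `m = 0` (one more decimation of the perfect ONE-step resolvent is the perfect fully-decimated object, shifted units), no hypothesis left.
* §3 **`entryHyps_perfCol_one_holds`**: for ANY `𝒯 : EKer 4` with AbsMoment₂/(T0)/(T1), `EntryHyps Lc (colOf (KPerf Lc (sfStep Lc) (smStep 3 Lc) 1)) 𝒯` — the
  perfect ONE-step transport is admissible; **`hasSum_transport_m2Tensor_perfCol_one_holds`** / **`coarseTensor_perfCol_one_eq_m2Tensor_holds`** — β is
  invariant under transport through the perfect one-step minimiser (d = 4 marginality), K-side unconditional.
* §4 **`SPerfOf_SDec_succ_holds`**: leaf-08's N1-J∞ nesting `SPerfOf_SDec_succ` with the transport hypotheses (hg, hRb, hR) GONE (gen-1 leaf-06's `…_of_KSlot`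
  ∘ `convCKWall_holds`); only X1m-S (`hUb`, `hU`) and the geometric S-units remain.
-/

namespace Summit.QuantumFields.BalabanUV.Beta.FP.KSlotHolds

open Filter Topology
open Literature.MathematicalPhysics.QuantumFieldTheory.Balaban1983to89
open Literature.MathematicalPhysics.QuantumFieldTheory.Balaban1983to89.Beta
open DecimatedMomentSummable (AbsMoment₂)
open DressedMomentNormalisation (EKer m2Tensor coarseTensor dressedEntry EntryHyps)
open ExpKernelCalculus (MKer Decays)
open OneStepResolventKernel (Fib)
open OneStepKernelFamily (dec KInvStep)
open InterLevelTransport (transportV)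
open HessKerDressedLimit (limMKerOf)
open Summit.QuantumFields.BalabanUV.Beta.HessKerDressedUnits (unitK unitS counitK)
open Summit.QuantumFields.BalabanUV.Beta.GAN24.CombesThomas (sfStep smStep KStepUnit UnitDecayK CauchyDecayK ConvCKWall)
open Summit.QuantumFields.BalabanUV.Beta.GAN24.KSlotAssembly (convCKWall_holds)
open Summit.QuantumFields.BalabanUV.Beta.FP.PerfectObjects (KTot)
open Summit.QuantumFields.BalabanUV.Beta.FP.PerfectObjectsT (KPerf SPerfOf)
open Summit.QuantumFields.BalabanUV.Beta.FP.StationarityK (dec_KPerf_succ_of_decays)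
open Summit.QuantumFields.BalabanUV.Beta.FP.StationarityJ (SDec)
open Summit.QuantumFields.BalabanUV.Beta.FP.StationarityJConvC (SPerfOf_SDec_succ_of_KSlot)
open Summit.QuantumFields.BalabanUV.Beta.FP.TransportInfinityM (colOf entryHyps_perfCol hasSum_transport_m2Tensor_perfCol
  coarseTensor_perfCol_eq_m2Tensor)

noncomputable section

/-! ## §1 The adopted units are geometric; the bond-unit pin holds -/

section Units

variable {d : ℕ} (Lc : ℕ)

/-- [folklore] `s_f(j+1) = Lc · s_f(j)`. -/
theorem sfStep_succ (j : ℕ) : sfStep Lc (j + 1) = (Lc : ℝ) * sfStep Lc j := by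
  unfold sfStep
  rw [pow_succ, mul_comm]

/-- [folklore] `s_m(j+1) = Lc^{d+1} · s_m(j)`. -/
theorem smStep_succ (j : ℕ) : smStep d Lc (j + 1) = (Lc : ℝ) ^ (d + 1) * smStep d Lc j := by
  unfold smStep
  rw [Nat.succ_mul, pow_add, mul_comm]

/-- [folklore] THE BOND-UNIT PIN at `d = 3`: `s_f(j) · s_m(j) = Lc^j · Lc^{4j} = Lc^{5j}` (the `hunit` of `TransportInfinityM` / `StepLawAssembly`). -/
theorem sfStep_mul_smStep_three (j : ℕ) : sfStep Lc j * smStep 3 Lc j = (Lc : ℝ) ^ (5 * j) := by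
  unfold sfStep smStep
  rw [← pow_add]
  congr 1
  ring

end Units

variable {Lc : ℕ} [NeZero Lc]

/-! ## §2 N1-K∞ at `m = 0`, unconditional -/

/-- **THE FIXED-POINT PROPERTY OF THE PERFECT ONE-STEP RESOLVENT, NO HYPOTHESIS LEFT** (`d = 3`, `2 ≤ Lc`, adopted units): one more `Lc`-decimation of
`KPerf Lc (sfStep Lc) (smStep 3 Lc) 1` IS the perfect fully-decimated resolvent `KPerf … 0` read in the once-shifted units —
`StationarityK.dec_KPerf_succ_of_decays` at `m = 0` with its all-scales hypothesis supplied by `convCKWall_holds`. [our object] -/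
theorem dec_KPerf_one_holds (hLc : 2 ≤ Lc) :
    dec Lc (KPerf (d := 3) Lc (sfStep Lc) (smStep 3 Lc) 1) =
      unitK ((Lc : ℝ))⁻¹ ((Lc : ℝ) ^ (3 + 1))⁻¹ (KPerf (d := 3) Lc (sfStep Lc) (smStep 3 Lc) 0) := by
  obtain ⟨C, δ, cK, θ, _hδ, _hθ0, hθ1, _hK, hKall⟩ := convCKWall_holds hLc
  have hLc0 : (Lc : ℝ) ≠ 0 := Nat.cast_ne_zero.2 (NeZero.ne Lc)
  exact dec_KPerf_succ_of_decays (d := 3) (Lc := Lc) (sf := sfStep Lc) (sm := smStep 3 Lc) (m := 0) hLc0 (pow_ne_zero _ hLc0)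
    (sfStep_succ Lc) (smStep_succ Lc) (fun k j => hKall k j) hθ1

/-! ## §3 N5b-2 at `m = 1`: the perfect one-step transport is admissible, K-side unconditional -/

/-- **THE PERFECT ONE-STEP RESOLVENT's COLUMN IS AN ADMISSIBLE TRANSPORT WEIGHT** (`d = 3`, `2 ≤ Lc`): for ANY kernel `𝒯 : EKer 4` with absolutely summable
second moments and vanishing zeroth/first moments, `EntryHyps Lc (colOf (KPerf Lc (sfStep Lc) (smStep 3 Lc) 1)) 𝒯` — `TransportInfinityM.entryHyps_perfCol`
at `m = 1`, its `hK`/`hKall` supplied by `convCKWall_holds`, its `hunit` by `sfStep_mul_smStep_three`. [our object] -/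
theorem entryHyps_perfCol_one_holds (hLc : 2 ≤ Lc) {𝒯 : EKer 4} (hT : ∀ c e, AbsMoment₂ (𝒯 c e)) (hT0 : ∀ c e, HasSum (𝒯 c e) 0)
    (hT1 : ∀ c e (μ : Fin 4), HasSum (fun t => t μ • 𝒯 c e t) 0) :
    EntryHyps Lc (colOf (KPerf (d := 3) Lc (sfStep Lc) (smStep 3 Lc) 1)) 𝒯 := by
  obtain ⟨C, δ, cK, θ, hδ, _hθ0, hθ1, hK, hKall⟩ := convCKWall_holds hLc
  have h := entryHyps_perfCol (sfStep_mul_smStep_three Lc) 1 ((hK 0).nonneg (Sum.inl 0)) hδ (fun j => hK j) (fun k j => hKall k j) hθ1 hT hT0 hT1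
  rwa [pow_one] at h

/-- **TRANSPORT INVARIANCE THROUGH THE PERFECT ONE-STEP MINIMISER, `HasSum` form** (an4's `hasSum_transport_m2Tensor` shape; `d = 3`, `2 ≤ Lc`). [our object] -/
theorem hasSum_transport_m2Tensor_perfCol_one_holds (hLc : 2 ≤ Lc) {𝒯 : EKer 4} (hT : ∀ c e, AbsMoment₂ (𝒯 c e))
    (hT0 : ∀ c e, HasSum (𝒯 c e) 0) (hT1 : ∀ c e (μ : Fin 4), HasSum (fun t => t μ • 𝒯 c e t) 0) (κ lam a b : Fin 4) :
    HasSum (fun t : Fin 4 → ℤ => (t κ * t lam) •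
      (((Lc : ℕ) : ℝ) ^ 8 * dressedEntry (colOf (KPerf (d := 3) Lc (sfStep Lc) (smStep 3 Lc) 1)) 𝒯 (((Lc : ℕ) : ℤ) • t) a b)) (m2Tensor 𝒯 κ lam a b) := by
  obtain ⟨C, δ, cK, θ, hδ, _hθ0, hθ1, hK, hKall⟩ := convCKWall_holds hLc
  have h := hasSum_transport_m2Tensor_perfCol (sfStep_mul_smStep_three Lc) 1 ((hK 0).nonneg (Sum.inl 0)) hδ (fun j => hK j)
    (fun k j => hKall k j) hθ1 hT hT0 hT1 κ lam a b
  rwa [pow_one] at h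

/-- **β IS INVARIANT UNDER TRANSPORT THROUGH THE PERFECT ONE-STEP MINIMISER** (`coarseTensor Lc (colOf (KPerf …1)) 𝒯 = m2Tensor 𝒯`; `d = 3`, `2 ≤ Lc`) — the
d = 4 marginality at the fixed point, K-side unconditional; the Ward data of `𝒯` remain hypotheses. [our object] -/
theorem coarseTensor_perfCol_one_eq_m2Tensor_holds (hLc : 2 ≤ Lc) {𝒯 : EKer 4} (hT : ∀ c e, AbsMoment₂ (𝒯 c e))
    (hT0 : ∀ c e, HasSum (𝒯 c e) 0) (hT1 : ∀ c e (μ : Fin 4), HasSum (fun t => t μ • 𝒯 c e t) 0) :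
    coarseTensor Lc (colOf (KPerf (d := 3) Lc (sfStep Lc) (smStep 3 Lc) 1)) 𝒯 = m2Tensor 𝒯 := by
  obtain ⟨C, δ, cK, θ, hδ, _hθ0, hθ1, hK, hKall⟩ := convCKWall_holds hLc
  have h := coarseTensor_perfCol_eq_m2Tensor (sfStep_mul_smStep_three Lc) 1 ((hK 0).nonneg (Sum.inl 0)) hδ (fun j => hK j)
    (fun k j => hKall k j) hθ1 hT hT0 hT1
  rwa [pow_one] at h

/-! ## §4 N1-J∞: the transport side of the jet nesting, unconditional -/

/-- **leaf-08's N1-J AT THE LIMIT WITH THE TRANSPORT HYPOTHESES GONE** (`d = 3`, `2 ≤ Lc`): for geometric S-units `(sf, sm)` (ratios `rf, rm`) and under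
X1m-S ONLY (`hUb`: a `j`-uniform bound, `hU`: entrywise convergence of the rescaled (j, m+1) stencil family),
`SPerfOf sf sm SDec m = (Lc^5·(rf·rm)⁻¹) • transportV 1 ρ∞ (counitK rf rm ∘ dec Lc ∘ SPerfOf sf sm SDec (m+1))` with `ρ∞` the fm entries of
`limMKerOf (KStepUnit Lc)` — `StationarityJConvC.SPerfOf_SDec_succ_of_KSlot` ∘ `convCKWall_holds`. [our object] -/
theorem SPerfOf_SDec_succ_holds (hLc : 2 ≤ Lc) (cE cVH cΛ : ℝ) {sf sm : ℕ → ℝ} {rf rm : ℝ}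
    (hf : ∀ j, sf (j + 1) = rf * sf j) (hm : ∀ j, sm (j + 1) = rm * sm j) (m : ℕ) {B : ℝ}
    (hUb : ∀ j κ' u' x w a b, |unitS (sf j) (sm j) (SDec 3 Lc cE cVH cΛ j (m + 1)) κ' u' x w a b| ≤ B)
    (hU : ∀ κ' u' x w a b, ∃ L : ℝ, Tendsto (fun j => unitS (sf j) (sm j) (SDec 3 Lc cE cVH cΛ j (m + 1)) κ' u' x w a b) atTop (𝓝 L))
    (κ : Fin (3 + 1)) (u : Fin (3 + 1) → ℤ) :
    SPerfOf sf sm (SDec 3 Lc cE cVH cΛ) m κ u =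
      (((Lc : ℝ) ^ (3 + 2)) * (rf * rm)⁻¹) • transportV 1
        (fun μ z l'' w' => limMKerOf (KStepUnit (d := 3) Lc) w' (((Lc : ℕ) : ℤ) • z) (Sum.inl l'') (Sum.inr μ))
        (fun κ' u' => counitK rf rm (dec Lc (SPerfOf sf sm (SDec 3 Lc cE cVH cΛ) (m + 1) κ' u'))) κ u := by
  obtain ⟨C, δ, cK, θ, hδ, _hθ0, hθ1, hK, hKall⟩ := convCKWall_holds hLc
  exact SPerfOf_SDec_succ_of_KSlot (d := 3) (le_trans one_le_two hLc) cE cVH cΛ hf hm hδ hK hKall hθ1 m hUb hU κ u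

end

end Summit.QuantumFields.BalabanUV.Beta.FP.KSlotHolds
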